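import Literature.AlgebraicGeometry.AbelianVarieties.FourierMukaiExchangeTensor
import HarnessLib

/-!
# Discharge of the named fact `Mukai1981_exchangeTensor` (Mukai 1981 (3.1), second row, module level)

Layer `Literature/AlgebraicGeometry/AbelianVarieties`. The named fact
`AbelianVarieties/PoincareSheafOfPrincipal.Mukai1981_exchangeTensor` — for a principally polarised complex abelian variety
`(A, Θ)` with dual `Â = A.dualOf Θ hΘ`, Poincaré sheaf `𝒫`, Mukai's (underived) functor `Ŝ(M) = p_{Â*}(𝒫 ⊗ p_A^*M)`, every
complex point `α` of `Â` and every `𝒪_A`-module `M`, `Ŝ(M ⊗ P_α) ≅ t_α^*Ŝ(M)` (`P_α = 𝒫|_{A × {α}} = linePt A hΘ hK α`; the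
module-level row behind Mukai's (3.1) `RS ∘ (⊗ P_x) ≅ T_x^* ∘ RS`; Lange Prop. 6.1.16 (a)) — is PROVED, literally as typed,
by composing MODULE-LEVEL constructions already in the tree (their `D⁺`-level composite is
`FourierMukaiExchangeTensor.fourierMukaiPlusExchangeTensorIso`, which left the displayed module-level row "neither used nor
discharged"):

* the braiding `M ⊗ P_α ≅ P_α ⊗ M` (`Modules/TensorBraiding.tensorComm`);
* the exchange isomorphism of KERNEL functors on all of `Mod(𝒪_A)`,
  `𝒫 ⊗ p_A^*(P_α ⊗ M) ≅ (1 × t_α)^*(𝒫 ⊗ p_A^*M)` (`kernelExchangeTensorNatIso`);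
* base change of the direct image along the square of ISOMORPHISMS `(1 × t_α) ≫ p_Â = p_Â ≫ t_α`
  (`snd_comp_dualTranslationIso_hom`): `p_{Â*}((1 × t_α)^*Z) ≅ t_α^*(p_{Â*}Z)` — from `ε^* ≅ (ε⁻¹)_*`
  (`Modules/DerivedPushforwardIsoBaseChange.pullbackIsoPushforwardInv`) and Mathlib's `Scheme.Modules.pushforwardComp`,
  `pushforwardCongr` (the module-level form of `derivedPushforwardPlusBaseChangeIsoOfIso`).

One theorem, no definitions, no instances; no consumer of the fact is edited.

## References

* S. Mukai, *Duality between `D(X)` and `D(X̂)` with its application to Picard sheaves*, Nagoya Math. J. 81 (1981), §3 (3.1)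
  p. 158. [Mukai1981]
* H. Lange, *Abelian Varieties over the Complex Numbers* (2023), Prop. 6.1.16 (a). [Lange2023AbelianVarietiesComplex]
* R. Hartshorne, *Algebraic Geometry* (1977), III Prop. 9.3 (base change; here along an isomorphism). [Hartshorne1977]
-/

noncomputable section

-- `TopCat.Presheaf`/`Scheme.Modules` are not reducible (as in Mathlib's `AlgebraicGeometry/Modules/Sheaf.lean`).
set_option backward.isDefEq.respectTransparency false

open CategoryTheory CategoryTheory.Limits AlgebraicGeometry MonoidalCategory CartesianMonoidalCategory
open AlgebraicGeometry.Scheme.Modules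

namespace Literature.AlgebraicGeometry.AbelianVarieties

open Literature.AlgebraicGeometry.Motives Literature.AlgebraicGeometry.Modules
open scoped MonObj

/-- **Mukai 1981 (3.1), second row, module level, holds: `Ŝ(M ⊗ P_α) ≅ t_α^*Ŝ(M)`** for every complex point `α` of the
dual of a principally polarised complex abelian variety `A` and every `𝒪_A`-module `M` — the named fact
`Mukai1981_exchangeTensor`, discharged by composing the braiding, the kernel exchange `kernelExchangeTensorNatIso`, and base
change of `p_{Â*}` along the square of isomorphisms `(1 × t_α) ≫ p_Â = p_Â ≫ t_α`.
[cite: Mukai1981, §3 (3.1) p. 158] [cite: Lange2023AbelianVarietiesComplex, Prop. 6.1.16 (a)] -/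
theorem Mukai1981_exchangeTensor_holds : Mukai1981_exchangeTensor := by
  intro A Θ hΘ hK α M
  let Ah := A.dualOf Θ hΘ
  let p := (fst A.X Ah.X).left
  let q := (snd A.X Ah.X).left
  let e := unitProdTranslationIso A hΘ α
  let t := dualTranslationIso A hΘ α
  let Pc := poincareSheaf A hΘ hK
  let L := linePt A hΘ hK α
  let K := integralKernelFunctor p Pc
  -- `t_α` in the two spellings
  have ht : (Ah.translation α).left = t.hom := rfl
  -- the square of isomorphisms and its inverse form `e⁻¹ ≫ q = q ≫ t⁻¹`
  have sq : q ≫ t.hom = e.hom ≫ q := snd_comp_dualTranslationIso_hom A hΘ α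
  have w : e.inv ≫ q = q ≫ t.inv := by
    rw [← cancel_mono t.hom, Category.assoc, Category.assoc, sq, Iso.inv_hom_id_assoc, Iso.inv_hom_id,
      Category.comp_id]
  -- Step 1: braiding inside the kernel, then the kernel exchange: `𝒫 ⊗ p^*(M ⊗ P_α) ≅ e^*(K M)`
  let i₁ : K.obj (tensorObj M L) ≅ (Scheme.Modules.pullback e.hom).obj (K.obj M) :=
    K.mapIso (tensorComm M L) ≪≫ (kernelExchangeTensorNatIso A hΘ hK α).app M
  -- Step 2: base change of `q_*` along the square of isomorphisms: `q_*(e^* Z) ≅ t^*(q_* Z)`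
  let i₂ : Scheme.Modules.pullback e.hom ⋙ pushforward q ≅ pushforward q ⋙ Scheme.Modules.pullback t.hom :=
    Functor.isoWhiskerRight (pullbackIsoPushforwardInv e) (pushforward q) ≪≫
      Scheme.Modules.pushforwardComp e.inv q ≪≫ Scheme.Modules.pushforwardCongr w ≪≫
      (Scheme.Modules.pushforwardComp q t.inv).symm ≪≫
      Functor.isoWhiskerLeft (pushforward q) (pullbackIsoPushforwardInv t).symm
  refine ⟨?_⟩
  rw [ht]
  exact (pushforward q).mapIso i₁ ≪≫ i₂.app (K.obj M)

end Literature.AlgebraicGeometry.AbelianVarieties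

end
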